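import Summits.BirchSwinnertonDyer.BirchSwinnertonDyer.Theses.LeadingTerm
import Summits.BirchSwinnertonDyer.BirchSwinnertonDyer.Theorems.LeadingTermPinchPrimeCofiniteTorsion
import Summits.BirchSwinnertonDyer.BirchSwinnertonDyer.Theorems.LeadingTermPinchPrimeSemisimpleOfSchneiderAt
import Literature.NumberTheory.EllipticCurves.IwasawaSelmerDualProofs
import Literature.NumberTheory.EllipticCurves.SelmerInftyTorsionFiniteProofs
import Literature.NumberTheory.EllipticCurves.KatoRankBoundProofs
import Literature.NumberTheory.EllipticCurves.CanonicalPAdicHeightHolds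
import Literature.NumberTheory.EllipticCurves.ModPIrreducibleCofinite

/-!
# BirchSwinnertonDyer / LeadingTerm — crux `PinchPrime` (stmt-BirchSwinnertonDyer-16218),
# line `SketchIdeator2`, stub `stub_semisimpleInfinitelyOftenOfSchneider` (GLUE, v7: Schneider's
# conjecture ⟹ the line's open height-side stub, curve by curve)

Registered stub of the lead skeleton `Cruxes/PinchPrime/Lines/SketchIdeator2.lean` (v7). The
line `SketchIdeator2` reduces the crux to two OPEN stubs — `Ш(E/ℚ)[p^∞]` finite cofinitely in
`p`, and "`T` semisimple at `0` on `ℚ_p ⊗ X(E/ℚ_∞)` (`ker T² = ker T`) at infinitely many good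
ordinary `p` with the normalised cyclotomic datum" (Greenberg, LNM 1716, §1, Conj. 1.12 at
`T = 0`, asked infinitely often) — plus named facts. This file shows the second open stub is
IMPLIED, curve by curve, by Schneider's conjecture (non-degeneracy of the canonical cyclotomic
`p`-adic height at every good ordinary `p ≥ 5`; Schneider 1982 §1, Mazur–Stein–Tate 2006
Conj. 1.1) together with the first: modulo the four named facts Perrin-Riou–Schneider
(`Schneider1985_order_charGenerator`), Mazur's control theorem in corank form
(`Greenberg1999_coinvariantsRank_eq_selmerCorank_rat`), modularity (`exists_isNewformOf`) and BCS
(`burungale_castella_skinner_charIdeal_eq_padicLFunction`) — all HYPOTHESES (the four arrows).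

Proof: take a good ordinary prime above the given finite set, the `Ш`-exceptional set and the
BCS-torsion exceptional set (`WeierstrassCurve.infinite_goodOrdinaryPrimes_holds`, Serre/Deuring,
PROVED in the tree; `stub_cofiniteTorsion`, LANDED p133139), the normalised cyclotomic datum
(`exists_isCyclotomic_isTopGenerator_isCyclotomicVariable_holds`), the newform (modularity), the
canonical height datum (`exists_isCanonical_holds`), and apply the pointwise monotonicity lemma
`stub_semisimpleOfSchneiderAt` (LANDED p134208: PRS clause 2 + the corank squeeze + Greenberg's
`ord_T f_E = rank X/TX ↔ ker T² = ker T`).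
-/

noncomputable section

set_option linter.dupNamespace false

namespace Summit.BirchSwinnertonDyer.BirchSwinnertonDyer.Cruxes.PinchPrime.FirstLayerStability

open scoped MatrixGroups ModularForm
open CongruenceSubgroup Literature.NumberTheory.EllipticCurves
  Literature.NumberTheory.EllipticCurves.ModularForms
open Summit.BirchSwinnertonDyer.BirchSwinnertonDyer.Theses

/-- **Schneider's conjecture ⟹ semisimplicity of `T` at `0` infinitely often, curve by curve**
(stub `stub_semisimpleInfinitelyOftenOfSchneider` of crux `PinchPrime`, line `SketchIdeator2`).
Assume PRS, the control fact, modularity and BCS. Let `E/ℚ` be elliptic with globally minimal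
`W`; suppose `Reg_p(E, Dh) ≠ 0` for every good ordinary `p ≥ 5` and every canonical datum `Dh`,
and `Ш(E/ℚ)[p^∞]` finite for every good ordinary `p` outside a finite set. Then outside any
finite set `B` there is a good ordinary `p ≥ 5` with a cyclotomic `ℤ_p`-extension `κ` and a
normalised topological generator `γ` such that `ker T² = ker T` on `ℚ_p ⊗ X` for every Iwasawa
datum `D` (`X = D.X`). [cite: MazurSteinTate2006, Conj. 1.1]
[cite: GreenbergLNM1716, §1 Conj. 1.12 and p. 9] -/
theorem stub_semisimpleInfinitelyOftenOfSchneider :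
    Schneider1985_order_charGenerator → Greenberg1999_coinvariantsRank_eq_selmerCorank_rat →
    exists_isNewformOf → burungale_castella_skinner_charIdeal_eq_padicLFunction →
    ∀ (W : WeierstrassCurve ℚ) [W.IsElliptic] [W.IsGloballyMinimal],
      (∀ (p : ℕ) [Fact p.Prime], 5 ≤ p → IsOrdinaryAt W p →
        ∀ Dh : WeierstrassCurve.PAdicHeightData W p, Dh.IsCanonical →
          WeierstrassCurve.SchneiderConjecture Dh) →
      (∃ B : Finset ℕ, ∀ p ∉ B, ∀ [Fact p.Prime], IsOrdinaryAt W p →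
        Finite (AddCommGroup.primaryComponent W.sha p)) →
      ∀ B : Finset ℕ, ∃ p ∉ B, ∃ _ : Fact p.Prime, 5 ≤ p ∧ IsOrdinaryAt W p ∧
        ∃ (κ : ZpExtension ℚ p) (γ : Field.absoluteGaloisGroup ℚ),
          κ.IsCyclotomic ∧ κ.IsTopGenerator γ ∧ IsCyclotomicVariable p γ ∧
          ∀ D : W.SelmerDualData κ γ,
            LinearMap.ker (IwasawaAlgebra.mulTRat p D.X ∘ₗ IwasawaAlgebra.mulTRat p D.X)
              = LinearMap.ker (IwasawaAlgebra.mulTRat p D.X) := by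
  intro hPRS hcontrol hmod hBCS W _ _ hSch hSha B
  obtain ⟨B₁, hB₁⟩ := hSha
  obtain ⟨B₃, hB₃⟩ := stub_cofiniteTorsion hBCS W
  -- a good ordinary prime above every exceptional one
  obtain ⟨p, ⟨hp, hgood, hnd⟩, hgt⟩ :=
    (WeierstrassCurve.infinite_goodOrdinaryPrimes_holds W).exists_gt ((B ∪ B₁ ∪ B₃).sup id + 4)
  haveI : Fact p.Prime := hp
  have hnot : ∀ {s : Finset ℕ}, s ⊆ B ∪ B₁ ∪ B₃ → p ∉ s := fun {s} hs hps ↦ by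
    have hle : p ≤ (B ∪ B₁ ∪ B₃).sup id := Finset.le_sup (f := id) (hs hps)
    omega
  have hpB : p ∉ B := hnot (Finset.subset_union_left.trans Finset.subset_union_left)
  have hp1 : p ∉ B₁ := hnot (Finset.subset_union_right.trans Finset.subset_union_left)
  have hp3 : p ∉ B₃ := hnot Finset.subset_union_right
  have h5 : 5 ≤ p := by omega
  have hord : IsOrdinaryAt W p := ⟨hgood, hnd⟩
  -- the normalised cyclotomic datum, the newform, the canonical height datum
  obtain ⟨κ, hκ, γ, hγ, hγ'⟩ := exists_isCyclotomic_isTopGenerator_isCyclotomicVariable_holds p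
  haveI : NeZero (W.conductorNorm ℤ) := ⟨(WeierstrassCurve.conductorNorm_pos_holds (W := W)).ne'⟩
  obtain ⟨f, hf⟩ := hmod W
  obtain ⟨Dh, hDh⟩ := WeierstrassCurve.exists_isCanonical_holds W p h5 hgood hnd
  refine ⟨p, hpB, hp, h5, hord, κ, γ, hκ, hγ, hγ', fun D ↦ ?_⟩
  haveI : Module.Finite (IwasawaAlgebra p) D.X := D.module_finite_of_isCyclotomic W κ hκ hγ
  exact stub_semisimpleOfSchneiderAt hPRS hcontrol W p h5 hord κ γ hκ hγ hγ' D
    (hB₃ p hp3 h5 hord κ γ hκ hγ hγ' f hf D) (hB₁ p hp1 hord) Dh hDh (hSch p h5 hord Dh hDh)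

end Summit.BirchSwinnertonDyer.BirchSwinnertonDyer.Cruxes.PinchPrime.FirstLayerStability

end
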